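import Summits.FinalStateConjecture.FinalStateConjecture.Theorems.ClusterCompletenessOmegaLimitMultiKerrFluxTransfer
import Summits.FinalStateConjecture.FinalStateConjecture.Theorems.ClusterCompletenessOmegaLimitMultiKerrTranslateLipschitz
import Summits.FinalStateConjecture.FinalStateConjecture.Theorems.ClusterCompletenessOmegaLimitMultiKerrFluxFatou
import Summits.FinalStateConjecture.FinalStateConjecture.Theorems.ClusterCompletenessOmegaLimitMultiKerrAsymptoticStationarity
import HarnessLib

/-!
# Route ClusterCompleteness · crux `OmegaLimitMultiKerr` — TAME + TRANSFER ⇒ every ω-limit is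
# STATIONARY (invariant under the background's Killing translation)

Structure lemma for the crux stmt-FinalStateConjecture-14664 (`ClusterCompleteness.OmegaLimitMultiKerr`,
rank 9), line `Sketch`, lead gen 5, registered stub
`omegaLimit_translate_eq_self_of_tame_transfer` (closed form). It is the COMPOSITION of this
cycle's LaSalle layer, and the typed form of the first half of the "dark-limit dictionary" of the
recommended re-line (leads 0–c4; idea cards `lasalle-lands-on-liminf`, `long-coarse-windows-…`):

**Theorem.** Let `h : E → W` (the deviation field of a late chart, extended by zero) be `C^{k+1}`
on an open domain `O` invariant under all translations by `e` (the Killing translation of the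
boosted Kerr–Schild background), TAME on the forward tubes `Kⱼ + [a, ∞) e ⊆ O` of a family of
sets `Kⱼ` covering `O` (derivatives of orders `1 … k+1` bounded by `Λⱼ`). Let `Φⱼ` be local
fluxes which, along the orbit, are nonnegative, `Cⱼ`-Lipschitz with respect to the `Cᵏ(Kⱼ)`
distance and sequentially continuous, and which satisfy the TRANSFER INEQUALITIES
`∫_{[t, t + Lⱼ]} Φⱼ (h (· + s • e)) ds ≤ C'ⱼ · (M (t − cⱼ) − M (t + Lⱼ + cⱼ)) + errⱼ t` (`t ≥ a`)
for ONE far-away quantity `M : ℝ → ℝ` convergent at `+∞` (final Bondi mass: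
`BondiSachsRadiativeEnd.IsCanonical.hasFinalBondiMass`) and errors `errⱼ → 0`. Then for every
ω-limit `g` of the translates of `h` (along any `Tₙ → +∞`, in `Cᵏ` on compacts of `O`),
differentiable on `O`, on which the fluxes are DEFINITE for `∂ₑ`
(`Φⱼ g = 0 ⇒ ∂ₑ g = 0` on `Kⱼ ∩ O`): `g (x + s • e) = g x` for all `x ∈ O`, `s ∈ ℝ`.

Second form `omegaLimit_translate_eq_self_of_transfer_of_continuous` — NO TAMENESS IN TIME: by the
Fatou form of the invariance principle (`…FluxFatou`, p127706) the Lipschitz hypothesis on the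
fluxes is replaced by mere continuity of `t ↦ Φⱼ (h (· + t • e))` on `[a, ∞)` and continuity of
`s ↦ Φⱼ (g (· + s • e))` (window integrals `→ 0` force the flux to vanish on a.e. translate of
`g`, hence on all of them).

Headline composition `tendsto_supCkENorm_fderiv_translate_of_transfer` (second registered stub of
this file) — TAME + TRANSFER ⇒ THE DEVELOPMENT IS ASYMPTOTICALLY STATIONARY in era gauge: under
`C^{k+2}` tameness on compacts and the Fatou-route hypotheses for every candidate limit, `∂ₑ` of the
translates tends to `0` in `Cᵏ` on every compact as `t → +∞` (every `C^{k+1}_loc` ω-limit is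
`e`-invariant, hence `∂ₑ`-free — `fderiv_apply_eq_zero_of_translate_eq_self` — and
`tendsto_supCkENorm_fderiv_translate_of_omegaLimits_stationary`, p127988, converts "all ω-limits
stationary" into the asymptotics of `h` itself by compactness + the subsequence principle).

Proof = `uniformContinuousOn_comp_translate` (tameness ⇒ the flux is Lipschitz in time, p127365)
→ `flux_omegaLimit_translate_eq_zero_of_transfer` (window Barbalat + squeeze + invariance
principle: the flux vanishes on every translate of `g`) → `omegaLimit_translate_eq_self_of_definite_flux`
(`∂ₑ g = 0` on `O` ⇒ `e`-invariance, mean value theorem). What is NOT here, and is thereby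
isolated as the physics input of the identification stub: (a) the transfer inequality for some
`∂ₑ`-definite local flux of the chart fields from the Bondi mass-loss law (an energy identity
between a compact chart region and null infinity); (b) rigidity of the resulting stationary vacuum
ω-limits (stationary + asymptotically flat + horizon ⇒ Kerr); (c) generic tameness. LaSalle 1960;
Hale 1980, Ch. X §1.
-/

-- every `Summit.FinalStateConjecture.FinalStateConjecture.…` name repeats the summit = sub-problem segment (D-0017 layout)
set_option linter.dupNamespace false

noncomputable section

open Set Filter Topology Function
open scoped ContDiff Topology ENNReal

namespace Summit.FinalStateConjecture.FinalStateConjecture.Theorems.ClusterCompleteness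

open Literature.Geometry.Lorentzian MeasureTheory

/-- **Tame + transfer ⇒ ω-limits are stationary** (registered structure stub of line `Sketch`,
crux stmt-FinalStateConjecture-14664; closed form; see the module docstring for the reading).
Hypotheses, in order: `O` open and invariant under the translations by `e`; `h` of class `C^{k+1}`
on `O`; a family `Kx j` covering `O` with forward tubes `Kx j + [a, ∞) e ⊆ O` on which the
derivatives of `h` of orders `1 … k + 1` are bounded by `Λ j` (TAMENESS); fluxes `Φ j` nonnegative
along the orbit after time `a`, `C j`-Lipschitz along the orbit for the `supCkENorm (Kx j) k`
distance (`0 ≤ C j`), sequentially continuous along the orbit, and obeying the TRANSFER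
inequalities with window widths `L j > 0`, lags `c j`, constants `C' j`, a common far quantity
`M → Mf` and errors `err j → 0`; an ω-limit `g` of `h` along `T → +∞`, differentiable on `O`, on
which each `Φ j` is definite for `∂ₑ`. Conclusion: `g (x + s • e) = g x` on `O`.
LaSalle 1960; Hale 1980, Ch. X, §1, Thm. 1.3. [cite: Hale1980, Ch. X §1] -/
theorem omegaLimit_translate_eq_self_of_tame_transfer :
    ∀ {E : Type*} [NormedAddCommGroup E] [NormedSpace ℝ E]
      {W : Type*} [NormedAddCommGroup W] [NormedSpace ℝ W]
      {O : Set E} {e : E}, IsOpen O → (∀ x ∈ O, ∀ s : ℝ, x + s • e ∈ O) →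
      ∀ {k : ℕ} {h : E → W}, ContDiffOn ℝ (k + 1) h O →
      ∀ (Kx : ℕ → Set E) {a : ℝ} (Λ : ℕ → ℝ), O ⊆ ⋃ j, Kx j →
      (∀ j, ∀ x ∈ Kx j, ∀ τ : ℝ, a ≤ τ → x + τ • e ∈ O) →
      (∀ j i, 1 ≤ i → i ≤ k + 1 → ∀ x ∈ Kx j, ∀ τ : ℝ, a ≤ τ →
        ‖iteratedFDeriv ℝ i h (x + τ • e)‖ ≤ Λ j) →
      ∀ (Φ : ℕ → (E → W) → ℝ) (C : ℕ → ℝ), (∀ j, 0 ≤ C j) →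
      (∀ j, ∀ t ∈ Ici a, 0 ≤ Φ j (fun x ↦ h (x + t • e))) →
      (∀ j (t t' : ℝ), a ≤ t → a ≤ t' →
        dist (Φ j (fun x ↦ h (x + t • e))) (Φ j (fun x ↦ h (x + t' • e))) ≤
          C j * (supCkENorm (Kx j) k (fun x ↦ h (x + t • e) - h (x + t' • e))).toReal) →
      (∀ j (t : ℕ → ℝ) (g' : E → W), Tendsto t atTop atTop →
        (∀ K ⊆ O, IsCompact K →
          Tendsto (fun n ↦ supCkENorm K k (fun x ↦ h (x + t n • e) - g' x)) atTop (𝓝 0)) →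
        Tendsto (fun n ↦ Φ j (fun x ↦ h (x + t n • e))) atTop (𝓝 (Φ j g'))) →
      ∀ (M : ℝ → ℝ) (err : ℕ → ℝ → ℝ) (L c C' : ℕ → ℝ) {Mf : ℝ}, (∀ j, 0 < L j) →
      (∀ j, ∀ t ∈ Ici a, ∫ s in Icc t (t + L j), Φ j (fun x ↦ h (x + s • e)) ≤
        C' j * (M (t - c j) - M (t + L j + c j)) + err j t) →
      Tendsto M atTop (𝓝 Mf) → (∀ j, Tendsto (err j) atTop (𝓝 0)) →
      ∀ {g : E → W} {T : ℕ → ℝ}, Tendsto T atTop atTop →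
      (∀ K ⊆ O, IsCompact K →
        Tendsto (fun n ↦ supCkENorm K k (fun x ↦ h (x + T n • e) - g x)) atTop (𝓝 0)) →
      (∀ y ∈ O, DifferentiableAt ℝ g y) →
      (∀ j, Φ j g = 0 → ∀ y ∈ Kx j, y ∈ O → fderiv ℝ g y e = 0) →
      ∀ x ∈ O, ∀ s : ℝ, g (x + s • e) = g x := by
  intro E _ _ W _ _ O e hO hOe k h hh Kx a Λ hcov hray htame Φ C hC h0 hLip hΦ M err L c C' Mf
    hL htr hM herr g T hT hlim hg hdef
  -- every flux vanishes on every translate of the ω-limit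
  have hzero : ∀ j (s : ℝ), Φ j (fun x ↦ g (x + s • e)) = 0 := by
    intro j s
    -- tameness ⇒ the flux is uniformly continuous in time along the orbit
    have hu : UniformContinuousOn (fun t ↦ Φ j (fun x ↦ h (x + t • e))) (Ici a) :=
      uniformContinuousOn_comp_translate hO hh (hray j) (htame j) (Φ j) (hC j) (hLip j)
    exact flux_omegaLimit_translate_eq_zero_of_transfer hOe (Φ j) M (err j) (hL j) (h0 j) hu
      (htr j) hM (herr j) (hΦ j) hT hlim s
  exact omegaLimit_translate_eq_self_of_definite_flux hOe Kx hcov Φ hg hdef hzero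

/-- **Transfer ⇒ ω-limits are stationary, Fatou route (no tameness in time).** Same setting and
conclusion as `omegaLimit_translate_eq_self_of_tame_transfer`, but the fluxes are only asked to be
nonnegative and CONTINUOUS in time along the orbit on `[a, ∞)`, sequentially continuous along the
orbit, continuous along the translates of the ω-limit `g` (`s ↦ Φ j (g (· + s • e))`), to obey
the transfer inequalities, and to be definite for `∂ₑ` on `g`: the window integrals tend to `0`
(`tendsto_setIntegral_Icc_of_transfer`), so by the Fatou form
(`flux_omegaLimit_translate_eq_zero_of_tendsto_setIntegral_of_continuous`, p127706) every `Φ j`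
vanishes on all translates of `g`, and `omegaLimit_translate_eq_self_of_definite_flux` concludes.
LaSalle 1960; Hale 1980, Ch. X, §1. [cite: Hale1980, Ch. X §1] -/
theorem omegaLimit_translate_eq_self_of_transfer_of_continuous {E : Type*} [NormedAddCommGroup E]
    [NormedSpace ℝ E] {W : Type*} [NormedAddCommGroup W] [NormedSpace ℝ W] {O : Set E} {e : E}
    (hOe : ∀ x ∈ O, ∀ s : ℝ, x + s • e ∈ O) {k : ℕ} {h : E → W} (Kx : ℕ → Set E)
    (hcov : O ⊆ ⋃ j, Kx j) (Φ : ℕ → (E → W) → ℝ) {a : ℝ}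
    (h0 : ∀ j, ∀ t ∈ Ici a, 0 ≤ Φ j (fun x ↦ h (x + t • e)))
    (hcont : ∀ j, ContinuousOn (fun t : ℝ ↦ Φ j (fun x ↦ h (x + t • e))) (Ici a))
    (hΦ : ∀ j (t : ℕ → ℝ) (g' : E → W), Tendsto t atTop atTop →
      (∀ K ⊆ O, IsCompact K →
        Tendsto (fun n ↦ supCkENorm K k (fun x ↦ h (x + t n • e) - g' x)) atTop (𝓝 0)) →
      Tendsto (fun n ↦ Φ j (fun x ↦ h (x + t n • e))) atTop (𝓝 (Φ j g')))
    (M : ℝ → ℝ) (err : ℕ → ℝ → ℝ) (L c C' : ℕ → ℝ) {Mf : ℝ} (hL : ∀ j, 0 < L j)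
    (htr : ∀ j, ∀ t ∈ Ici a, ∫ s in Icc t (t + L j), Φ j (fun x ↦ h (x + s • e)) ≤
      C' j * (M (t - c j) - M (t + L j + c j)) + err j t)
    (hM : Tendsto M atTop (𝓝 Mf)) (herr : ∀ j, Tendsto (err j) atTop (𝓝 0))
    {g : E → W} {T : ℕ → ℝ} (hT : Tendsto T atTop atTop)
    (hlim : ∀ K ⊆ O, IsCompact K →
      Tendsto (fun n ↦ supCkENorm K k (fun x ↦ h (x + T n • e) - g x)) atTop (𝓝 0))
    (hgc : ∀ j, Continuous fun s : ℝ ↦ Φ j (fun x ↦ g (x + s • e)))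
    (hg : ∀ y ∈ O, DifferentiableAt ℝ g y)
    (hdef : ∀ j, Φ j g = 0 → ∀ y ∈ Kx j, y ∈ O → fderiv ℝ g y e = 0) :
    ∀ x ∈ O, ∀ s : ℝ, g (x + s • e) = g x := by
  have hzero : ∀ j (s : ℝ), Φ j (fun x ↦ g (x + s • e)) = 0 := by
    intro j s
    -- window integrals of the flux along the orbit tend to `0`
    have hw : Tendsto (fun t ↦ ∫ τ in Icc t (t + L j), Φ j (fun x ↦ h (x + τ • e))) atTop
        (𝓝 0) := by
      refine tendsto_setIntegral_Icc_of_transfer (fun t ht ↦ ?_) (htr j) hM (herr j)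
      exact setIntegral_nonneg measurableSet_Icc fun τ hτ ↦ h0 j τ (le_trans ht hτ.1)
    exact flux_omegaLimit_translate_eq_zero_of_tendsto_setIntegral_of_continuous hOe (Φ j) (hL j)
      (h0 j) (hcont j) hw (hΦ j) hT hlim (hgc j) s
  exact omegaLimit_translate_eq_self_of_definite_flux hOe Kx hcov Φ hg hdef hzero

/-! ### GR reading: hole charts on a boosted Kerr–Schild background -/

/-- **Hole-chart reading: transfer ⇒ the ω-limit chart metric is STATIONARY for the background's
Killing time.** For a hole chart on `boostedKerrBackground Λ c M a` (domain = the boosted exterior,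
invariant under the Killing translation `e = Λ∂₀`: `add_smul_mem_boostedKerrBackground_domain`),
let `h` be its deviation field (e.g. `𝓢.deviationExtend (boostedKerrBackground Λ c M a) Ψ`) and `g`
an ω-limit of its translates (as produced by `exists_omegaLimit_hole_translate`). Under the
hypotheses of `omegaLimit_translate_eq_self_of_transfer_of_continuous` (fluxes continuous in time,
nonnegative, continuous along the orbit and along the translates of `g`, transfer inequalities
against one far convergent quantity, definiteness for `∂ₑ` on `g`), the LIMIT CHART METRIC
`g + g_{M,a,Λ,c}` is invariant under the Killing translation on the whole boosted exterior
(`KerrSchildChart.boostedKerrBilin_add_smul`): an eternal stationary object, the input shape of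
stationary-vacuum rigidity. [cite: Hale1980, Ch. X §1] -/
theorem hole_omegaLimit_chartMetric_stationary_of_transfer (Λ : lorentzGroup) (c : E4) (M a : ℝ)
    {k : ℕ} {h : E4 → E4 →L[ℝ] E4 →L[ℝ] ℝ} (Kx : ℕ → Set E4)
    (hcov : ((boostedKerrBackground Λ c M a).domain : Set E4) ⊆ ⋃ j, Kx j)
    (Φ : ℕ → (E4 → E4 →L[ℝ] E4 →L[ℝ] ℝ) → ℝ) {a₀ : ℝ}
    (h0 : ∀ j, ∀ t ∈ Ici a₀, 0 ≤ Φ j (fun x ↦ h (x +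
      t • (Λ : E4 ≃L[ℝ] E4) (EuclideanSpace.single (0 : Fin 4) (1 : ℝ)))))
    (hcont : ∀ j, ContinuousOn (fun t : ℝ ↦ Φ j (fun x ↦ h (x +
      t • (Λ : E4 ≃L[ℝ] E4) (EuclideanSpace.single (0 : Fin 4) (1 : ℝ))))) (Ici a₀))
    (hΦ : ∀ j (t : ℕ → ℝ) (g' : E4 → E4 →L[ℝ] E4 →L[ℝ] ℝ), Tendsto t atTop atTop →
      (∀ K ⊆ ((boostedKerrBackground Λ c M a).domain : Set E4), IsCompact K →
        Tendsto (fun n ↦ supCkENorm K k (fun x ↦ h (x +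
          t n • (Λ : E4 ≃L[ℝ] E4) (EuclideanSpace.single (0 : Fin 4) (1 : ℝ))) - g' x))
          atTop (𝓝 0)) →
      Tendsto (fun n ↦ Φ j (fun x ↦ h (x +
        t n • (Λ : E4 ≃L[ℝ] E4) (EuclideanSpace.single (0 : Fin 4) (1 : ℝ))))) atTop
        (𝓝 (Φ j g')))
    (Mfar : ℝ → ℝ) (err : ℕ → ℝ → ℝ) (L lag C' : ℕ → ℝ) {Mf : ℝ} (hL : ∀ j, 0 < L j)
    (htr : ∀ j, ∀ t ∈ Ici a₀, ∫ s in Icc t (t + L j), Φ j (fun x ↦ h (x +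
        s • (Λ : E4 ≃L[ℝ] E4) (EuclideanSpace.single (0 : Fin 4) (1 : ℝ)))) ≤
      C' j * (Mfar (t - lag j) - Mfar (t + L j + lag j)) + err j t)
    (hM : Tendsto Mfar atTop (𝓝 Mf)) (herr : ∀ j, Tendsto (err j) atTop (𝓝 0))
    {g : E4 → E4 →L[ℝ] E4 →L[ℝ] ℝ} {T : ℕ → ℝ} (hT : Tendsto T atTop atTop)
    (hlim : ∀ K ⊆ ((boostedKerrBackground Λ c M a).domain : Set E4), IsCompact K →
      Tendsto (fun n ↦ supCkENorm K k (fun x ↦ h (x +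
        T n • (Λ : E4 ≃L[ℝ] E4) (EuclideanSpace.single (0 : Fin 4) (1 : ℝ))) - g x)) atTop (𝓝 0))
    (hgc : ∀ j, Continuous fun s : ℝ ↦ Φ j (fun x ↦ g (x +
      s • (Λ : E4 ≃L[ℝ] E4) (EuclideanSpace.single (0 : Fin 4) (1 : ℝ)))))
    (hg : ∀ y ∈ ((boostedKerrBackground Λ c M a).domain : Set E4), DifferentiableAt ℝ g y)
    (hdef : ∀ j, Φ j g = 0 → ∀ y ∈ Kx j, y ∈ ((boostedKerrBackground Λ c M a).domain : Set E4) →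
      fderiv ℝ g y ((Λ : E4 ≃L[ℝ] E4) (EuclideanSpace.single (0 : Fin 4) (1 : ℝ))) = 0) :
    ∀ x ∈ ((boostedKerrBackground Λ c M a).domain : Set E4), ∀ s : ℝ,
      g (x + s • (Λ : E4 ≃L[ℝ] E4) (EuclideanSpace.single (0 : Fin 4) (1 : ℝ))) +
          boostedKerrBilin Λ c M a
            (x + s • (Λ : E4 ≃L[ℝ] E4) (EuclideanSpace.single (0 : Fin 4) (1 : ℝ))) =
        g x + boostedKerrBilin Λ c M a x := by
  intro x hx s
  rw [KerrSchildChart.boostedKerrBilin_add_smul,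
    omegaLimit_translate_eq_self_of_transfer_of_continuous
      (add_smul_mem_boostedKerrBackground_domain (Λ := Λ) (c := c) (M := M) (a := a)) Kx hcov Φ
      h0 hcont hΦ Mfar err L lag C' hL htr hM herr hT hlim hgc hg hdef x hx s]

/-! ### Tame + transfer ⇒ asymptotically stationary -/

/-- **Translation-invariance kills the `e`-derivative**: if `g (y + s • e) = g y` for all `s` and
`g` is differentiable at `y`, then `fderiv ℝ g y e = 0` (the line map `s ↦ g (y + s • e)` is
constant and has derivative `fderiv ℝ g y e` at `s = 0`). [folklore] -/
theorem fderiv_apply_eq_zero_of_translate_eq_self {E : Type*} [NormedAddCommGroup E]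
    [NormedSpace ℝ E] {W : Type*} [NormedAddCommGroup W] [NormedSpace ℝ W] {e : E} {g : E → W}
    {y : E} (hg : DifferentiableAt ℝ g y) (hinv : ∀ s : ℝ, g (y + s • e) = g y) :
    fderiv ℝ g y e = 0 := by
  have h1 : HasDerivAt (fun σ : ℝ ↦ y + σ • e) e 0 := by
    simpa using ((hasDerivAt_id (0 : ℝ)).smul_const e).const_add y
  have h2 : HasDerivAt (fun σ : ℝ ↦ g (y + σ • e)) (fderiv ℝ g (y + (0 : ℝ) • e) e) 0 := by
    have hg0 : DifferentiableAt ℝ g (y + (0 : ℝ) • e) := by simpa using hg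
    exact hg0.hasFDerivAt.comp_hasDerivAt (0 : ℝ) h1
  simp only [zero_smul, add_zero] at h2
  have h3 : HasDerivAt (fun σ : ℝ ↦ g (y + σ • e)) 0 0 := by
    have : (fun σ : ℝ ↦ g (y + σ • e)) = fun _ ↦ g y := funext hinv
    rw [this]
    exact hasDerivAt_const 0 (g y)
  exact h2.unique h3

/-- **Tame + transfer ⇒ asymptotically stationary** (second registered structure stub of this file, line
`Sketch`, crux stmt-FinalStateConjecture-14664; closed form; see the module docstring). Hypotheses:
`O` open, `e`-invariant; `h ∈ C^{k+2}(O)`; TAMENESS at order `k + 2` on compacts; a cover `Kx` of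
`O`; fluxes `Φ j`: nonnegative and continuous in time along the orbit after `a`, sequentially
continuous along the orbit for `C^{k+1}_loc` convergence, continuous along the translates of every
`C^{k+1}` field, definite for `∂ₑ` on `C^{k+1}` fields; TRANSFER inequalities with `L j > 0` against
one convergent `M` with `err j → 0`. Conclusion: `∂ₑ` of the translates tends to `0` in `Cᵏ` on every
compact. LaSalle 1960; Hale 1980, Ch. X, §1. [cite: Hale1980, Ch. X §1] -/
theorem tendsto_supCkENorm_fderiv_translate_of_transfer :
    ∀ {E : Type*} [NormedAddCommGroup E] [NormedSpace ℝ E] [FiniteDimensional ℝ E]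
      {W : Type*} [NormedAddCommGroup W] [NormedSpace ℝ W] [FiniteDimensional ℝ W]
      {O : Set E} {e : E}, IsOpen O → (∀ x ∈ O, ∀ s : ℝ, x + s • e ∈ O) →
      ∀ {k : ℕ} {h : E → W}, ContDiffOn ℝ (k + 2) h O →
      (∀ K ⊆ O, IsCompact K → ∃ Λ a : ℝ, ∀ t : ℝ, a ≤ t → ∀ i, i ≤ k + 2 → ∀ z ∈ K,
        ‖iteratedFDeriv ℝ i h (z + t • e)‖ ≤ Λ) →
      ∀ (Kx : ℕ → Set E), O ⊆ ⋃ j, Kx j →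
      ∀ (Φ : ℕ → (E → W) → ℝ) {a : ℝ},
      (∀ j, ∀ t ∈ Ici a, 0 ≤ Φ j (fun x ↦ h (x + t • e))) →
      (∀ j, ContinuousOn (fun t : ℝ ↦ Φ j (fun x ↦ h (x + t • e))) (Ici a)) →
      (∀ j (t : ℕ → ℝ) (g' : E → W), Tendsto t atTop atTop →
        (∀ K ⊆ O, IsCompact K →
          Tendsto (fun n ↦ supCkENorm K (k + 1) (fun x ↦ h (x + t n • e) - g' x)) atTop (𝓝 0)) →
        Tendsto (fun n ↦ Φ j (fun x ↦ h (x + t n • e))) atTop (𝓝 (Φ j g'))) →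
      (∀ (g : E → W) (j : ℕ), ContDiffOn ℝ (k + 1) g O →
        Continuous fun s : ℝ ↦ Φ j (fun x ↦ g (x + s • e))) →
      (∀ (g : E → W) (j : ℕ), ContDiffOn ℝ (k + 1) g O → Φ j g = 0 →
        ∀ y ∈ Kx j, y ∈ O → fderiv ℝ g y e = 0) →
      ∀ (M : ℝ → ℝ) (err : ℕ → ℝ → ℝ) (L c C' : ℕ → ℝ) {Mf : ℝ}, (∀ j, 0 < L j) →
      (∀ j, ∀ t ∈ Ici a, ∫ s in Icc t (t + L j), Φ j (fun x ↦ h (x + s • e)) ≤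
        C' j * (M (t - c j) - M (t + L j + c j)) + err j t) →
      Tendsto M atTop (𝓝 Mf) → (∀ j, Tendsto (err j) atTop (𝓝 0)) →
      ∀ K ⊆ O, IsCompact K →
        Tendsto (fun t : ℝ ↦ supCkENorm K k (fun x ↦ fderiv ℝ h (x + t • e) e)) atTop (𝓝 0) := by
  intro E _ _ _ W _ _ _ O e hO hOe k h hh htame Kx hcov Φ a h0 hcont hΦ hgc hdef M err L c C' Mf
    hL htr hM herr K hKO hK
  refine tendsto_supCkENorm_fderiv_translate_of_omegaLimits_stationary hO hOe hh htame ?_ K hKO hK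
  -- every `C^{k+1}_loc` ω-limit is `e`-invariant, hence has vanishing `e`-derivative
  intro g T hg hT hconv y hy
  have hgd : ∀ z ∈ O, DifferentiableAt ℝ g z := fun z hz ↦
    (hg.contDiffAt (hO.mem_nhds hz)).differentiableAt (by simp)
  have hinv : ∀ x ∈ O, ∀ s : ℝ, g (x + s • e) = g x :=
    omegaLimit_translate_eq_self_of_transfer_of_continuous hOe Kx hcov Φ h0 hcont hΦ M err L c C'
      hL htr hM herr hT hconv (fun j ↦ hgc g j hg) hgd (fun j ↦ hdef g j hg)
  exact fderiv_apply_eq_zero_of_translate_eq_self (hgd y hy) (hinv y hy)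


end Summit.FinalStateConjecture.FinalStateConjecture.Theorems.ClusterCompleteness

end
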